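import Literature.AlgebraicGeometry.Frobenioids.BirationalNormalizationExampleClauses
import Literature.AlgebraicGeometry.Frobenioids.BiratFrobeniusCompactCriterion
import HarnessLib

/-!
# Frobenioids I, Example 4.6: "every object of `(C^un-tr)^birat` is Frobenius-compact" — PROVED

Mochizuki, *The geometry of Frobenioids I: the general theory*, Kyushu J. Math. **62** (2008)
293–400, kurims text p. 87 [cite: MochizukiFrdI2008, Ex. 4.6 p.87]: "… and, moreover, every object of
`(C^un-tr)^birat` is Frobenius-compact." PROOF-ONLY; sequel of `BirationalNormalizationExampleClauses.lean`
(seat abc-iut-L1-t8), at THE unit-trivialization `C^un-tr` (`untrFunctor`, seat abc-iut-L1-d5/found) and THE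
birationalization (seat abc-iut-L6-t8), via seat abc-iut-L6-t10's criterion
`PreFrobenioid.Birat.untr_isFrobeniusCompact_of_invariant` (one non-torsion, automorphism-invariant element of
`Φ^birat(A_D)` suffices): here `d₀ = (1,0) − (0,1) ∈ Φ^birat` (the divisor of the birational unit
`[(0,1,0,1) ; (0,0,1,1)]`), non-torsion in `ℤ²`, and invariant because the base is the one-morphism category.
No statement of the paper is strengthened; nothing here takes a side on [IUTchIII] Cor. 3.12.
-/

namespace Literature.AlgebraicGeometry.Frobenioids

open CategoryTheory Opposite

namespace Ex46

open PreFrobenioid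

variable {G : Type} [AddCommGroup G] (P : Datum G)

/-- **Example 4.6: "every object of `(C^un-tr)^birat` is Frobenius-compact"** (FrdI p. 87) — PROVED for every
object `A` of `C^un-tr` (whose objects are all the objects of `(C^un-tr)^birat`). [cite: MochizukiFrdI2008, Ex. 4.6 p.87] -/
theorem untrBirat_isFrobeniusCompact (hF : IsFrobenioid (toElem P))
    (A : (PreFrobenioidData.ofFunctor Φ (toElem P)).Untr) :
    (biratOps (isFrobenioid_untr hF) (hasBiratSquares_untr hF)).IsFrobeniusCompact
      ((toBirat (untrFunctor hF) (isFrobenioid_untr hF) (hasBiratSquares_untr hF)).obj A) := by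
  -- the germ `d₀ = (1,0) − (0,1)` at an object of `C` (all base objects coincide)
  let E : Obj P := ⟨(A₀ P).idx - 1⟩
  obtain ⟨δ₁, h₁⟩ := exists_hom P E (A₀ P) 0 1 0 1 zero_le_one le_rfl (by simp [E])
  obtain ⟨δ₂, h₂⟩ := exists_hom P E (A₀ P) 0 0 1 1 le_rfl zero_le_one (by simp [E])
  have hδ₁ : IsCoAngularPreStep (toElem P) δ₁ := (isCoAngularPreStep_iff P δ₁).mpr (by rw [h₁])
  have hδ₂ : IsPreStep (toElem P) δ₂ := (isPreStep_iff P δ₂).mpr (by rw [h₂])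
  have hmem := div_invDiv_mem_biratSubfunctor (toElem P) δ₁ δ₂ hδ₁ hδ₂ (Subsingleton.elim _ _)
  rw [invDiv_eq, invDiv_eq, div_eq, div_eq, h₁, h₂] at hmem
  -- non-torsion: `(N, 0) ≠ (0, N)` in `ℤ_{≥0}²` for `N ≥ 1`
  have hinj := isPreDivisorial_NN.isIntegral.injective_of
  refine Birat.untr_isFrobeniusCompact_of_invariant hF A _ hmem (fun N hN hN1 => ?_) (fun f => ?_)
  · have hN1' : (Algebra.GrothendieckGroup.of (Multiplicative.ofAdd (((1 : ℕ), (0 : ℕ))) : Multiplicative (ℕ × ℕ)) /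
        Algebra.GrothendieckGroup.of (Multiplicative.ofAdd (((0 : ℕ), (1 : ℕ))) : Multiplicative (ℕ × ℕ)) :
          Algebra.GrothendieckGroup (Multiplicative (ℕ × ℕ))) ^ N = 1 := hN1
    rw [div_pow, ← map_pow (Algebra.GrothendieckGroup.of (M := Multiplicative (ℕ × ℕ))),
      ← map_pow (Algebra.GrothendieckGroup.of (M := Multiplicative (ℕ × ℕ))), div_eq_one] at hN1'
    have h := congrArg (fun x : Multiplicative (ℕ × ℕ) => (Multiplicative.toAdd x).1) (hinj hN1')
    simp only [toAdd_pow, toAdd_ofAdd, Prod.smul_fst, smul_eq_mul, mul_one, mul_zero] at h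
    omega
  · rw [Subsingleton.elim (Birat.gpBase f.inv) (𝟙 _), pullGp_id]

end Ex46

end Literature.AlgebraicGeometry.Frobenioids
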